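import Summits.BirchSwinnertonDyer.Rank1Residual.X11a.VisibilityRecordsNoRam
import Summits.BirchSwinnertonDyer.Rank1Residual.X11a.VisibilityRecords6
import Summits.BirchSwinnertonDyer.Rank1Residual.X11a.VisibilityRecords10
import Summits.BirchSwinnertonDyer.Rank1Residual.X11a.VisibilityRecords11
import Summits.BirchSwinnertonDyer.Rank1Residual.X11b.MultiplicativeSurjectivity
import Summits.BirchSwinnertonDyer.Rank1Residual.X11b.CertificateCheckBridge
import Literature.NumberTheory.EllipticCurves.OrdinaryPrimesProofs
import Literature.NumberTheory.EllipticCurves.LFunctionPrimeCoeff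
import Literature.NumberTheory.DiophantineGeometry.LocalReduction
import HarnessLib

/-!
# Class X11a — per-pair VISIBILITY records with the CLASS ATOMS in the kernel, file 5
# (cell `bsd-print-x11a`, seat p4)

HONEST FRAMING (cells `b2b-bsdres` / `bsd-print-x11a`, verbatim): the goal is to DELETE the
COMBINATION-SHAPED residual classes of the Birch–Swinnerton-Dyer formula for ALL analytic-rank
`≤ 1` elliptic curves over `ℚ` — "full BSD formula for every rank `≤ 1` curve in class `C`"
assembled STRICTLY from published theorems — so that the rank-`≤ 1` remainder becomes exactly the
CONSTRUCTION-SHAPED classes, which are TYPED (missing-input `Prop`s), NOT attempted. This is not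
"finishing BSD". PER PAIR: theorems only, no definition, no named fact; nothing is booked by this
file and no class label changes (referee / planner).

## What

For every record `bsdp<p>_v<label>` of `X11a/VisibilityRecords1…32.lean` (94 rank-`0` X11-type
pairs of the x11a gen-9 census) this file discharges the displayed class binder `hX : ClassX11a W p`
IN THE KERNEL up to the analytic rank: `classX11a_c<label> : W = ⟨…⟩ → W.analyticRank = 0 →
ClassX11a W p` — `p ∥ N` from the integral model (`p ∣ Δ`, `p ∤ c₄`; Silverman VII.5.1 (b)),
`E[p]` irreducible by a Frobenius witness (a good prime `ℓ` with `X² − a_ℓ X + ℓ` irreducible mod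
`p`, `a_ℓ` from the kernel point count `countPoints`; Mazur 1978 Prop. 6.3 (1), tree
`hasIrreducibleModPGaloisRep_of_intModel_of_noroot`), and NO (ram) prime by `not_ram_of_intModel`
(`X11a/VisibilityRecordsNoRam.lean`: every prime of `Δ` is `p`, additive, or multiplicative with `p ∣ ord_ℓ Δ`) — and restates the
record as `bsdp<p>_a<label>` with `hr : W.analyticRank = 0` in place of `hX`, the image bit
`ρ̄_{E,p}` onto in the kernel wherever `E` is très ramifié at `p` (x11c's `ClassX11a.surj_of_not_dvd`).
Displayed binders LEFT per record: `hr` (`r_an = 0`, Cremona `allbsd`), `hq`/`hv` (`#Ш_an = p²`),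
`θ`/`hθ` (the `p`-congruence, Sturm two-engine, x11a g9), `hrank` (`rank F(ℚ) = 2`, Cremona),
and `hsurj` only at the peu ramifié rows.

References: [SilvermanAEC2009] VII.5.1; [Mazur1978] Prop. 6.3; [SerreInventiones1972] §2.4 Prop. 15;
[Wuthrich2014] Prop. 21; [CremonaMazur2000] §3; [Miller2011LMS] Def. 1.1; [Cremona2006];
`X11a/VisibilityRecords1.lean` (template); HOME `run/shared/lean/pub/bsd-print-x11a/P4-RECORDS-TABLE.md`.
-/

set_option autoImplicit false

noncomputable section

open scoped Classical

open WeierstrassCurve Literature.NumberTheory.EllipticCurves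
  Literature.NumberTheory.EllipticCurves.Rank1Residual
  Literature.NumberTheory.EllipticCurves.Rank1Residual.Typed
  Literature.NumberTheory.EllipticCurves.Rank1Residual.X11RankOneCertificates
  Literature.NumberTheory.EllipticCurves.Wuthrich2014
  NumberField IsDedekindDomain Rat.HeightOneSpectrum
  Summit.BirchSwinnertonDyer.BirchSwinnertonDyer.Rank1Residual.IntModel

namespace Summit.BirchSwinnertonDyer.Rank1Residual.X11a.VisibilityRecords

/-! ### `141120ek3 @ 5` -/

/-- **`141120ek3 = [0, 0, 0, -11213536908, -462715414141232]` lies in class X11a at `5`, in the KERNEL up to `r_an = 0`**: `5 ∥ N`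
(`5 ∣ Δ = ±2¹⁵·3¹³·5¹⁶·7¹⁰`, `5 ∤ c₄`: multiplicative, Silverman VII.5.1 (b)); `E[5]` irreducible by the
Frobenius witness `ℓ = 11` (`#Ẽ(𝔽_11) = 8`, `a_11 = 4`, `X² − a_11X + 11` has no root mod `5`;
Mazur 1978 Prop. 6.3 (1)); no (ram) prime (`2` additive; `3` additive; `5 = p`; `7` additive). Displayed: `hr` (`r_an = 0`, Cremona).
[cite: SilvermanAEC2009, VII.5 Prop. 5.1] [cite: Mazur1978, §6 Prop. 6.3 (1) (p. 153)] [cite: Cremona2006, Table 1 (Cremona label 141120ek3)] -/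
theorem classX11a_c141120ek3 (W : WeierstrassCurve ℚ) [W.IsElliptic] [W.IsGloballyMinimal] [Fact (Nat.Prime 5)]
    (hWeq : W = ⟨0, 0, 0, -11213536908, -462715414141232⟩) (hr : W.analyticRank = 0) : ClassX11a W 5 := by
  haveI : Fact (Nat.Prime 2) := ⟨Nat.prime_two⟩
  haveI : Fact (Nat.Prime 3) := ⟨Nat.prime_three⟩
  haveI : Fact (Nat.Prime 7) := ⟨by norm_num⟩
  haveI : Fact (Nat.Prime 11) := ⟨by norm_num⟩
  have hI : integralModelInt W = ⟨0, 0, 0, -11213536908, -462715414141232⟩ := by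
    subst hWeq; exact integralModelInt_eq_of_map_eq _ (map_mk_int 0 0 0 (-11213536908) (-462715414141232))
  have hmult : Mult W 5 :=
    hasMultiplicativeReductionAtPrime_of_intModel hI 5 (by decide +kernel) (by decide +kernel)
  have hirr : Irr W 5 := by
    have hc : Nat.card (((⟨0, 0, 0, -11213536908, -462715414141232⟩ : WeierstrassCurve ℤ).map
        (Int.castRingHom (ZMod 11))).toAffine.Point) = 8 := by
      have h := X11b.natCard_point_eq_countPoints 0 0 0 (-11213536908) (-462715414141232) 11 (by norm_num)
        (by decide +kernel)
      have h' : countPoints [0, 0, 0, -11213536908, -462715414141232] 11 = 8 := by decide +kernel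
      exact_mod_cast h.trans h'
    exact hasIrreducibleModPGaloisRep_of_intModel_of_noroot (hp := ⟨by norm_num⟩) (hℓ := ⟨by norm_num⟩)
      hI 5 11 (by norm_num) (by decide +kernel) hc (by decide)
  have hnram : ¬ Ram W 5 := not_ram_of_intModel hI 5 [2, 3, 5, 7] [15, 13, 16, 10]
    (by intro q hq; simp only [List.mem_cons, List.mem_nil_iff, or_false] at hq
        rcases hq with rfl | rfl | rfl | rfl <;> norm_num) (by decide +kernel)
    (by intro ℓ hℓ; simp only [List.mem_cons, List.mem_nil_iff, or_false] at hℓ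
        rcases hℓ with rfl | rfl | rfl | rfl
        · exact Or.inr (Or.inl (by decide +kernel))
        · exact Or.inr (Or.inl (by decide +kernel))
        · exact Or.inl rfl
        · exact Or.inr (Or.inl (by decide +kernel)))
  exact ⟨hr, by decide, hmult, hirr, hnram⟩

/-- **`141120ek3 @ 5`: `BSD(E,5)` with the class atoms in the kernel** — `bsdp5_v141120ek3`
(`X11a/VisibilityRecords10.lean`) with `hX` supplied by `classX11a_c141120ek3`; image bit in the kernel (très ramifié, `ClassX11a.surj_of_not_dvd`). Displayed binders
left: `hr` (`r_an = 0`), `hq`/`hv` (`#Ш_an = 25`), `θ`/`hθ` (the `5`-congruence), `hrank` (`rank F(ℚ) = 2`).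
PER PAIR; nothing booked. [cite: Wuthrich2014, Prop. 21 (p. 400)] [cite: CremonaMazur2000, §3 and Table 1]
[cite: Cremona2006, Table 1 (Cremona label 141120ek3)] -/
theorem bsdp5_a141120ek3 (hCT : exists_casselsTate_pairing (K := ℚ)) (hW : sha_dvd_analyticSha)
    (hGZK : rank_eq_analyticRank_of_analyticRank_le_one) (hmod : hasEntireLFunction_rat)
    (W : WeierstrassCurve ℚ) [W.IsElliptic] [W.IsGloballyMinimal] [Fact (Nat.Prime 5)]
    (hWeq : W = ⟨0, 0, 0, -11213536908, -462715414141232⟩) (hr : W.analyticRank = 0)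
    {q : ℚ} (hq : shaAn W = (q : ℂ)) (hv : padicValRat 5 q ≤ 2)
    (W' : WeierstrassCurve ℚ) (hW' : W' = ⟨0, 0, 0, -148323, 23466688⟩) [W'.IsElliptic]
    (θ : geomTorsion W' ((5 : ℕ) : ℤ) ≃+ geomTorsion W ((5 : ℕ) : ℤ))
    (hθ : ∀ (σ : Field.absoluteGaloisGroup ℚ) (P : geomTorsion W' ((5 : ℕ) : ℤ)),
      θ (σ • P) = σ • θ P)
    (hrank : 2 ≤ W'.mordellWeilRank) : BSDp W 5 := by
  have hX : ClassX11a W 5 := classX11a_c141120ek3 W hWeq hr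
  have hsurj : Surj W 5 := ClassX11a.surj_of_not_dvd W 5 hX (by
    rw [minimalDiscriminantInt_eq (integralModelInt_eq_of_map_eq (W := W) _ (by rw [hWeq]; exact map_mk_int 0 0 0 (-11213536908) (-462715414141232))),
      padicValInt_eq_of_dvd_of_not_dvd 5 (e := 16) (by decide +kernel) (by decide +kernel)]
    decide)
  exact bsdp5_v141120ek3 hCT hW hGZK hmod W hWeq hX hsurj hq hv W' hW' θ hθ hrank

/-! ### `141120ek4 @ 5` -/

/-- **`141120ek4 = [0, 0, 0, -180033840588, -29402166520305488]` lies in class X11a at `5`, in the KERNEL up to `r_an = 0`**: `5 ∥ N`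
(`5 ∣ Δ = ±2¹⁵·3¹³·5⁴·7⁷`, `5 ∤ c₄`: multiplicative, Silverman VII.5.1 (b)); `E[5]` irreducible by the
Frobenius witness `ℓ = 11` (`#Ẽ(𝔽_11) = 8`, `a_11 = 4`, `X² − a_11X + 11` has no root mod `5`;
Mazur 1978 Prop. 6.3 (1)); no (ram) prime (`2` additive; `3` additive; `5 = p`; `7` additive). Displayed: `hr` (`r_an = 0`, Cremona).
[cite: SilvermanAEC2009, VII.5 Prop. 5.1] [cite: Mazur1978, §6 Prop. 6.3 (1) (p. 153)] [cite: Cremona2006, Table 1 (Cremona label 141120ek4)] -/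
theorem classX11a_c141120ek4 (W : WeierstrassCurve ℚ) [W.IsElliptic] [W.IsGloballyMinimal] [Fact (Nat.Prime 5)]
    (hWeq : W = ⟨0, 0, 0, -180033840588, -29402166520305488⟩) (hr : W.analyticRank = 0) : ClassX11a W 5 := by
  haveI : Fact (Nat.Prime 2) := ⟨Nat.prime_two⟩
  haveI : Fact (Nat.Prime 3) := ⟨Nat.prime_three⟩
  haveI : Fact (Nat.Prime 7) := ⟨by norm_num⟩
  haveI : Fact (Nat.Prime 11) := ⟨by norm_num⟩
  have hI : integralModelInt W = ⟨0, 0, 0, -180033840588, -29402166520305488⟩ := by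
    subst hWeq; exact integralModelInt_eq_of_map_eq _ (map_mk_int 0 0 0 (-180033840588) (-29402166520305488))
  have hmult : Mult W 5 :=
    hasMultiplicativeReductionAtPrime_of_intModel hI 5 (by decide +kernel) (by decide +kernel)
  have hirr : Irr W 5 := by
    have hc : Nat.card (((⟨0, 0, 0, -180033840588, -29402166520305488⟩ : WeierstrassCurve ℤ).map
        (Int.castRingHom (ZMod 11))).toAffine.Point) = 8 := by
      have h := X11b.natCard_point_eq_countPoints 0 0 0 (-180033840588) (-29402166520305488) 11 (by norm_num)
        (by decide +kernel)
      have h' : countPoints [0, 0, 0, -180033840588, -29402166520305488] 11 = 8 := by decide +kernel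
      exact_mod_cast h.trans h'
    exact hasIrreducibleModPGaloisRep_of_intModel_of_noroot (hp := ⟨by norm_num⟩) (hℓ := ⟨by norm_num⟩)
      hI 5 11 (by norm_num) (by decide +kernel) hc (by decide)
  have hnram : ¬ Ram W 5 := not_ram_of_intModel hI 5 [2, 3, 5, 7] [15, 13, 4, 7]
    (by intro q hq; simp only [List.mem_cons, List.mem_nil_iff, or_false] at hq
        rcases hq with rfl | rfl | rfl | rfl <;> norm_num) (by decide +kernel)
    (by intro ℓ hℓ; simp only [List.mem_cons, List.mem_nil_iff, or_false] at hℓ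
        rcases hℓ with rfl | rfl | rfl | rfl
        · exact Or.inr (Or.inl (by decide +kernel))
        · exact Or.inr (Or.inl (by decide +kernel))
        · exact Or.inl rfl
        · exact Or.inr (Or.inl (by decide +kernel)))
  exact ⟨hr, by decide, hmult, hirr, hnram⟩

/-- **`141120ek4 @ 5`: `BSD(E,5)` with the class atoms in the kernel** — `bsdp5_v141120ek4`
(`X11a/VisibilityRecords10.lean`) with `hX` supplied by `classX11a_c141120ek4`; image bit in the kernel (très ramifié, `ClassX11a.surj_of_not_dvd`). Displayed binders
left: `hr` (`r_an = 0`), `hq`/`hv` (`#Ш_an = 25`), `θ`/`hθ` (the `5`-congruence), `hrank` (`rank F(ℚ) = 2`).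
PER PAIR; nothing booked. [cite: Wuthrich2014, Prop. 21 (p. 400)] [cite: CremonaMazur2000, §3 and Table 1]
[cite: Cremona2006, Table 1 (Cremona label 141120ek4)] -/
theorem bsdp5_a141120ek4 (hCT : exists_casselsTate_pairing (K := ℚ)) (hW : sha_dvd_analyticSha)
    (hGZK : rank_eq_analyticRank_of_analyticRank_le_one) (hmod : hasEntireLFunction_rat)
    (W : WeierstrassCurve ℚ) [W.IsElliptic] [W.IsGloballyMinimal] [Fact (Nat.Prime 5)]
    (hWeq : W = ⟨0, 0, 0, -180033840588, -29402166520305488⟩) (hr : W.analyticRank = 0)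
    {q : ℚ} (hq : shaAn W = (q : ℂ)) (hv : padicValRat 5 q ≤ 2)
    (W' : WeierstrassCurve ℚ) (hW' : W' = ⟨0, 0, 0, -148323, 23466688⟩) [W'.IsElliptic]
    (θ : geomTorsion W' ((5 : ℕ) : ℤ) ≃+ geomTorsion W ((5 : ℕ) : ℤ))
    (hθ : ∀ (σ : Field.absoluteGaloisGroup ℚ) (P : geomTorsion W' ((5 : ℕ) : ℤ)),
      θ (σ • P) = σ • θ P)
    (hrank : 2 ≤ W'.mordellWeilRank) : BSDp W 5 := by
  have hX : ClassX11a W 5 := classX11a_c141120ek4 W hWeq hr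
  have hsurj : Surj W 5 := ClassX11a.surj_of_not_dvd W 5 hX (by
    rw [minimalDiscriminantInt_eq (integralModelInt_eq_of_map_eq (W := W) _ (by rw [hWeq]; exact map_mk_int 0 0 0 (-180033840588) (-29402166520305488))),
      padicValInt_eq_of_dvd_of_not_dvd 5 (e := 4) (by decide +kernel) (by decide +kernel)]
    decide)
  exact bsdp5_v141120ek4 hCT hW hGZK hmod W hWeq hX hsurj hq hv W' hW' θ hθ hrank

/-! ### `141120ng1 @ 5` -/

/-- **`141120ng1 = [0, 0, 0, -3716748, -2757999888]` lies in class X11a at `5`, in the KERNEL up to `r_an = 0`**: `5 ∥ N`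
(`5 ∣ Δ = ±2²⁰·3⁶·5·7⁸`, `5 ∤ c₄`: multiplicative, Silverman VII.5.1 (b)); `E[5]` irreducible by the
Frobenius witness `ℓ = 13` (`#Ẽ(𝔽_13) = 14`, `a_13 = 0`, `X² − a_13X + 13` has no root mod `5`;
Mazur 1978 Prop. 6.3 (1)); no (ram) prime (`2` additive; `3` additive; `5 = p`; `7` additive). Displayed: `hr` (`r_an = 0`, Cremona).
[cite: SilvermanAEC2009, VII.5 Prop. 5.1] [cite: Mazur1978, §6 Prop. 6.3 (1) (p. 153)] [cite: Cremona2006, Table 1 (Cremona label 141120ng1)] -/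
theorem classX11a_c141120ng1 (W : WeierstrassCurve ℚ) [W.IsElliptic] [W.IsGloballyMinimal] [Fact (Nat.Prime 5)]
    (hWeq : W = ⟨0, 0, 0, -3716748, -2757999888⟩) (hr : W.analyticRank = 0) : ClassX11a W 5 := by
  haveI : Fact (Nat.Prime 2) := ⟨Nat.prime_two⟩
  haveI : Fact (Nat.Prime 3) := ⟨Nat.prime_three⟩
  haveI : Fact (Nat.Prime 7) := ⟨by norm_num⟩
  haveI : Fact (Nat.Prime 13) := ⟨by norm_num⟩
  have hI : integralModelInt W = ⟨0, 0, 0, -3716748, -2757999888⟩ := by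
    subst hWeq; exact integralModelInt_eq_of_map_eq _ (map_mk_int 0 0 0 (-3716748) (-2757999888))
  have hmult : Mult W 5 :=
    hasMultiplicativeReductionAtPrime_of_intModel hI 5 (by decide +kernel) (by decide +kernel)
  have hirr : Irr W 5 := by
    have hc : Nat.card (((⟨0, 0, 0, -3716748, -2757999888⟩ : WeierstrassCurve ℤ).map
        (Int.castRingHom (ZMod 13))).toAffine.Point) = 14 := by
      have h := X11b.natCard_point_eq_countPoints 0 0 0 (-3716748) (-2757999888) 13 (by norm_num)
        (by decide +kernel)
      have h' : countPoints [0, 0, 0, -3716748, -2757999888] 13 = 14 := by decide +kernel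
      exact_mod_cast h.trans h'
    exact hasIrreducibleModPGaloisRep_of_intModel_of_noroot (hp := ⟨by norm_num⟩) (hℓ := ⟨by norm_num⟩)
      hI 5 13 (by norm_num) (by decide +kernel) hc (by decide)
  have hnram : ¬ Ram W 5 := not_ram_of_intModel hI 5 [2, 3, 5, 7] [20, 6, 1, 8]
    (by intro q hq; simp only [List.mem_cons, List.mem_nil_iff, or_false] at hq
        rcases hq with rfl | rfl | rfl | rfl <;> norm_num) (by decide +kernel)
    (by intro ℓ hℓ; simp only [List.mem_cons, List.mem_nil_iff, or_false] at hℓ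
        rcases hℓ with rfl | rfl | rfl | rfl
        · exact Or.inr (Or.inl (by decide +kernel))
        · exact Or.inr (Or.inl (by decide +kernel))
        · exact Or.inl rfl
        · exact Or.inr (Or.inl (by decide +kernel)))
  exact ⟨hr, by decide, hmult, hirr, hnram⟩

/-- **`141120ng1 @ 5`: `BSD(E,5)` with the class atoms in the kernel** — `bsdp5_v141120ng1`
(`X11a/VisibilityRecords6.lean`) with `hX` supplied by `classX11a_c141120ng1`; image bit in the kernel (très ramifié, `ClassX11a.surj_of_not_dvd`). Displayed binders
left: `hr` (`r_an = 0`), `hq`/`hv` (`#Ш_an = 25`), `θ`/`hθ` (the `5`-congruence), `hrank` (`rank F(ℚ) = 2`).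
PER PAIR; nothing booked. [cite: Wuthrich2014, Prop. 21 (p. 400)] [cite: CremonaMazur2000, §3 and Table 1]
[cite: Cremona2006, Table 1 (Cremona label 141120ng1)] -/
theorem bsdp5_a141120ng1 (hCT : exists_casselsTate_pairing (K := ℚ)) (hW : sha_dvd_analyticSha)
    (hGZK : rank_eq_analyticRank_of_analyticRank_le_one) (hmod : hasEntireLFunction_rat)
    (W : WeierstrassCurve ℚ) [W.IsElliptic] [W.IsGloballyMinimal] [Fact (Nat.Prime 5)]
    (hWeq : W = ⟨0, 0, 0, -3716748, -2757999888⟩) (hr : W.analyticRank = 0)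
    {q : ℚ} (hq : shaAn W = (q : ℂ)) (hv : padicValRat 5 q ≤ 2)
    (W' : WeierstrassCurve ℚ) (hW' : W' = ⟨0, 0, 0, -588, 206192⟩) [W'.IsElliptic]
    (θ : geomTorsion W' ((5 : ℕ) : ℤ) ≃+ geomTorsion W ((5 : ℕ) : ℤ))
    (hθ : ∀ (σ : Field.absoluteGaloisGroup ℚ) (P : geomTorsion W' ((5 : ℕ) : ℤ)),
      θ (σ • P) = σ • θ P)
    (hrank : 2 ≤ W'.mordellWeilRank) : BSDp W 5 := by
  have hX : ClassX11a W 5 := classX11a_c141120ng1 W hWeq hr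
  have hsurj : Surj W 5 := ClassX11a.surj_of_not_dvd W 5 hX (by
    rw [minimalDiscriminantInt_eq (integralModelInt_eq_of_map_eq (W := W) _ (by rw [hWeq]; exact map_mk_int 0 0 0 (-3716748) (-2757999888))),
      padicValInt_eq_of_dvd_of_not_dvd 5 (e := 1) (by decide +kernel) (by decide +kernel)]
    decide)
  exact bsdp5_v141120ng1 hCT hW hGZK hmod W hWeq hX hsurj hq hv W' hW' θ hθ hrank

/-! ### `141120ng2 @ 5` -/

/-- **`141120ng2 = [0, 0, 0, 25918452, 26168326128]` lies in class X11a at `5`, in the KERNEL up to `r_an = 0`**: `5 ∥ N`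
(`5 ∣ Δ = ±2³²·3⁶·5⁷·7⁸`, `5 ∤ c₄`: multiplicative, Silverman VII.5.1 (b)); `E[5]` irreducible by the
Frobenius witness `ℓ = 13` (`#Ẽ(𝔽_13) = 14`, `a_13 = 0`, `X² − a_13X + 13` has no root mod `5`;
Mazur 1978 Prop. 6.3 (1)); no (ram) prime (`2` additive; `3` additive; `5 = p`; `7` additive). Displayed: `hr` (`r_an = 0`, Cremona).
[cite: SilvermanAEC2009, VII.5 Prop. 5.1] [cite: Mazur1978, §6 Prop. 6.3 (1) (p. 153)] [cite: Cremona2006, Table 1 (Cremona label 141120ng2)] -/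
theorem classX11a_c141120ng2 (W : WeierstrassCurve ℚ) [W.IsElliptic] [W.IsGloballyMinimal] [Fact (Nat.Prime 5)]
    (hWeq : W = ⟨0, 0, 0, 25918452, 26168326128⟩) (hr : W.analyticRank = 0) : ClassX11a W 5 := by
  haveI : Fact (Nat.Prime 2) := ⟨Nat.prime_two⟩
  haveI : Fact (Nat.Prime 3) := ⟨Nat.prime_three⟩
  haveI : Fact (Nat.Prime 7) := ⟨by norm_num⟩
  haveI : Fact (Nat.Prime 13) := ⟨by norm_num⟩
  have hI : integralModelInt W = ⟨0, 0, 0, 25918452, 26168326128⟩ := by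
    subst hWeq; exact integralModelInt_eq_of_map_eq _ (map_mk_int 0 0 0 25918452 26168326128)
  have hmult : Mult W 5 :=
    hasMultiplicativeReductionAtPrime_of_intModel hI 5 (by decide +kernel) (by decide +kernel)
  have hirr : Irr W 5 := by
    have hc : Nat.card (((⟨0, 0, 0, 25918452, 26168326128⟩ : WeierstrassCurve ℤ).map
        (Int.castRingHom (ZMod 13))).toAffine.Point) = 14 := by
      have h := X11b.natCard_point_eq_countPoints 0 0 0 25918452 26168326128 13 (by norm_num)
        (by decide +kernel)
      have h' : countPoints [0, 0, 0, 25918452, 26168326128] 13 = 14 := by decide +kernel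
      exact_mod_cast h.trans h'
    exact hasIrreducibleModPGaloisRep_of_intModel_of_noroot (hp := ⟨by norm_num⟩) (hℓ := ⟨by norm_num⟩)
      hI 5 13 (by norm_num) (by decide +kernel) hc (by decide)
  have hnram : ¬ Ram W 5 := not_ram_of_intModel hI 5 [2, 3, 5, 7] [32, 6, 7, 8]
    (by intro q hq; simp only [List.mem_cons, List.mem_nil_iff, or_false] at hq
        rcases hq with rfl | rfl | rfl | rfl <;> norm_num) (by decide +kernel)
    (by intro ℓ hℓ; simp only [List.mem_cons, List.mem_nil_iff, or_false] at hℓ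
        rcases hℓ with rfl | rfl | rfl | rfl
        · exact Or.inr (Or.inl (by decide +kernel))
        · exact Or.inr (Or.inl (by decide +kernel))
        · exact Or.inl rfl
        · exact Or.inr (Or.inl (by decide +kernel)))
  exact ⟨hr, by decide, hmult, hirr, hnram⟩

/-- **`141120ng2 @ 5`: `BSD(E,5)` with the class atoms in the kernel** — `bsdp5_v141120ng2`
(`X11a/VisibilityRecords6.lean`) with `hX` supplied by `classX11a_c141120ng2`; image bit in the kernel (très ramifié, `ClassX11a.surj_of_not_dvd`). Displayed binders
left: `hr` (`r_an = 0`), `hq`/`hv` (`#Ш_an = 25`), `θ`/`hθ` (the `5`-congruence), `hrank` (`rank F(ℚ) = 2`).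
PER PAIR; nothing booked. [cite: Wuthrich2014, Prop. 21 (p. 400)] [cite: CremonaMazur2000, §3 and Table 1]
[cite: Cremona2006, Table 1 (Cremona label 141120ng2)] -/
theorem bsdp5_a141120ng2 (hCT : exists_casselsTate_pairing (K := ℚ)) (hW : sha_dvd_analyticSha)
    (hGZK : rank_eq_analyticRank_of_analyticRank_le_one) (hmod : hasEntireLFunction_rat)
    (W : WeierstrassCurve ℚ) [W.IsElliptic] [W.IsGloballyMinimal] [Fact (Nat.Prime 5)]
    (hWeq : W = ⟨0, 0, 0, 25918452, 26168326128⟩) (hr : W.analyticRank = 0)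
    {q : ℚ} (hq : shaAn W = (q : ℂ)) (hv : padicValRat 5 q ≤ 2)
    (W' : WeierstrassCurve ℚ) (hW' : W' = ⟨0, 0, 0, -588, 206192⟩) [W'.IsElliptic]
    (θ : geomTorsion W' ((5 : ℕ) : ℤ) ≃+ geomTorsion W ((5 : ℕ) : ℤ))
    (hθ : ∀ (σ : Field.absoluteGaloisGroup ℚ) (P : geomTorsion W' ((5 : ℕ) : ℤ)),
      θ (σ • P) = σ • θ P)
    (hrank : 2 ≤ W'.mordellWeilRank) : BSDp W 5 := by
  have hX : ClassX11a W 5 := classX11a_c141120ng2 W hWeq hr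
  have hsurj : Surj W 5 := ClassX11a.surj_of_not_dvd W 5 hX (by
    rw [minimalDiscriminantInt_eq (integralModelInt_eq_of_map_eq (W := W) _ (by rw [hWeq]; exact map_mk_int 0 0 0 25918452 26168326128)),
      padicValInt_eq_of_dvd_of_not_dvd 5 (e := 7) (by decide +kernel) (by decide +kernel)]
    decide)
  exact bsdp5_v141120ng2 hCT hW hGZK hmod W hWeq hX hsurj hq hv W' hW' θ hθ hrank

/-! ### `158760dg1 @ 5` -/

/-- **`158760dg1 = [0, 0, 0, -290082303, -1901647275822]` lies in class X11a at `5`, in the KERNEL up to `r_an = 0`**: `5 ∥ N`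
(`5 ∣ Δ = ±2⁸·3¹²·5·7⁹`, `5 ∤ c₄`: multiplicative, Silverman VII.5.1 (b)); `E[5]` irreducible by the
Frobenius witness `ℓ = 13` (`#Ẽ(𝔽_13) = 9`, `a_13 = 5`, `X² − a_13X + 13` has no root mod `5`;
Mazur 1978 Prop. 6.3 (1)); no (ram) prime (`2` additive; `3` additive; `5 = p`; `7` additive). Displayed: `hr` (`r_an = 0`, Cremona).
[cite: SilvermanAEC2009, VII.5 Prop. 5.1] [cite: Mazur1978, §6 Prop. 6.3 (1) (p. 153)] [cite: Cremona2006, Table 1 (Cremona label 158760dg1)] -/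
theorem classX11a_c158760dg1 (W : WeierstrassCurve ℚ) [W.IsElliptic] [W.IsGloballyMinimal] [Fact (Nat.Prime 5)]
    (hWeq : W = ⟨0, 0, 0, -290082303, -1901647275822⟩) (hr : W.analyticRank = 0) : ClassX11a W 5 := by
  haveI : Fact (Nat.Prime 2) := ⟨Nat.prime_two⟩
  haveI : Fact (Nat.Prime 3) := ⟨Nat.prime_three⟩
  haveI : Fact (Nat.Prime 7) := ⟨by norm_num⟩
  haveI : Fact (Nat.Prime 13) := ⟨by norm_num⟩
  have hI : integralModelInt W = ⟨0, 0, 0, -290082303, -1901647275822⟩ := by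
    subst hWeq; exact integralModelInt_eq_of_map_eq _ (map_mk_int 0 0 0 (-290082303) (-1901647275822))
  have hmult : Mult W 5 :=
    hasMultiplicativeReductionAtPrime_of_intModel hI 5 (by decide +kernel) (by decide +kernel)
  have hirr : Irr W 5 := by
    have hc : Nat.card (((⟨0, 0, 0, -290082303, -1901647275822⟩ : WeierstrassCurve ℤ).map
        (Int.castRingHom (ZMod 13))).toAffine.Point) = 9 := by
      have h := X11b.natCard_point_eq_countPoints 0 0 0 (-290082303) (-1901647275822) 13 (by norm_num)
        (by decide +kernel)
      have h' : countPoints [0, 0, 0, -290082303, -1901647275822] 13 = 9 := by decide +kernel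
      exact_mod_cast h.trans h'
    exact hasIrreducibleModPGaloisRep_of_intModel_of_noroot (hp := ⟨by norm_num⟩) (hℓ := ⟨by norm_num⟩)
      hI 5 13 (by norm_num) (by decide +kernel) hc (by decide)
  have hnram : ¬ Ram W 5 := not_ram_of_intModel hI 5 [2, 3, 5, 7] [8, 12, 1, 9]
    (by intro q hq; simp only [List.mem_cons, List.mem_nil_iff, or_false] at hq
        rcases hq with rfl | rfl | rfl | rfl <;> norm_num) (by decide +kernel)
    (by intro ℓ hℓ; simp only [List.mem_cons, List.mem_nil_iff, or_false] at hℓ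
        rcases hℓ with rfl | rfl | rfl | rfl
        · exact Or.inr (Or.inl (by decide +kernel))
        · exact Or.inr (Or.inl (by decide +kernel))
        · exact Or.inl rfl
        · exact Or.inr (Or.inl (by decide +kernel)))
  exact ⟨hr, by decide, hmult, hirr, hnram⟩

/-- **`158760dg1 @ 5`: `BSD(E,5)` with the class atoms in the kernel** — `bsdp5_v158760dg1`
(`X11a/VisibilityRecords11.lean`) with `hX` supplied by `classX11a_c158760dg1`; image bit in the kernel (très ramifié, `ClassX11a.surj_of_not_dvd`). Displayed binders
left: `hr` (`r_an = 0`), `hq`/`hv` (`#Ш_an = 25`), `θ`/`hθ` (the `5`-congruence), `hrank` (`rank F(ℚ) = 2`).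
PER PAIR; nothing booked. [cite: Wuthrich2014, Prop. 21 (p. 400)] [cite: CremonaMazur2000, §3 and Table 1]
[cite: Cremona2006, Table 1 (Cremona label 158760dg1)] -/
theorem bsdp5_a158760dg1 (hCT : exists_casselsTate_pairing (K := ℚ)) (hW : sha_dvd_analyticSha)
    (hGZK : rank_eq_analyticRank_of_analyticRank_le_one) (hmod : hasEntireLFunction_rat)
    (W : WeierstrassCurve ℚ) [W.IsElliptic] [W.IsGloballyMinimal] [Fact (Nat.Prime 5)]
    (hWeq : W = ⟨0, 0, 0, -290082303, -1901647275822⟩) (hr : W.analyticRank = 0)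
    {q : ℚ} (hq : shaAn W = (q : ℂ)) (hv : padicValRat 5 q ≤ 2)
    (W' : WeierstrassCurve ℚ) (hW' : W' = ⟨0, 0, 0, -4683, 123382⟩) [W'.IsElliptic]
    (θ : geomTorsion W' ((5 : ℕ) : ℤ) ≃+ geomTorsion W ((5 : ℕ) : ℤ))
    (hθ : ∀ (σ : Field.absoluteGaloisGroup ℚ) (P : geomTorsion W' ((5 : ℕ) : ℤ)),
      θ (σ • P) = σ • θ P)
    (hrank : 2 ≤ W'.mordellWeilRank) : BSDp W 5 := by
  have hX : ClassX11a W 5 := classX11a_c158760dg1 W hWeq hr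
  have hsurj : Surj W 5 := ClassX11a.surj_of_not_dvd W 5 hX (by
    rw [minimalDiscriminantInt_eq (integralModelInt_eq_of_map_eq (W := W) _ (by rw [hWeq]; exact map_mk_int 0 0 0 (-290082303) (-1901647275822))),
      padicValInt_eq_of_dvd_of_not_dvd 5 (e := 1) (by decide +kernel) (by decide +kernel)]
    decide)
  exact bsdp5_v158760dg1 hCT hW hGZK hmod W hWeq hX hsurj hq hv W' hW' θ hθ hrank
end Summit.BirchSwinnertonDyer.Rank1Residual.X11a.VisibilityRecords

end
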